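import Mathlib
import Summits.PneNP.PneNP.Theorems.OverlapGapAlgebraNoStableSectionDefs

/-!
# Route OverlapGapAlgebra, crux `NoStableSection` (stmt-PneNP-2462), line `DartGame`: stub F

**The one Fubini split** (Bresler–Huang, arXiv:2106.02129, Prop. 4.7 (ii), §4.6), in exact
counting form over the typed path space `PathSp k m n`, for an ARBITRARY section `g`.

The instance at time `t₀ ≤ k·(m k)` reads literal position `(a, b)` from ONE of the `k + 1`
arrays, `c a b`, and an instance at a time at least one full sweep (`m k` steps) earlier never reads
array `c a b` at position `(a, b)` (`ind_src_ne`, `ind_coords`). Hence, conditionally on the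
coordinates of `Ψ` off the graph of `c` (which determine the earlier outputs of `g`), the instance
at time `t₀` is a free uniform instance, and the paths carrying a `J`-valid assignment `y` of small
conditional entropy relative to the earlier outputs are counted by a union bound over the
admissible `y` (`ind_fubini`) times the single-instance validity count
`#{Φ : violCount y Φ ≤ J} ≤ Σ_{j ≤ J} C(m,j) · (1 - 2^{-k})^{m-J} · #Inst` (`ind_card_violCount_le`,
a product count over clauses: exactly `n^k` of the `(2n)^k` clauses are falsified by `y`).

Main result: `stub_indepCount` (the registered stub `IndepCount` of the skeleton
`Cruxes/NoStableSection/Lines/DartGame.lean`).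
-/

namespace Summit.PneNP.PneNP.Cruxes.NoStableSection.DartGame

set_option linter.dupNamespace false

/-! ## Stub F, part 1: the single-instance validity count -/

section IndCount

open Finset

variable {k m n : ℕ}

/-- The clauses falsified by `y` are exactly the `n^k` clauses `r ↦ (v r, ! y (v r))`. -/
theorem ind_card_falsified (y : Fin n → Bool) :
    (univ.filter fun C : Fin k → Fin n × Bool => ∀ r, y (C r).1 ≠ (C r).2).card = n ^ k := by
  have key : (univ.filter fun C : Fin k → Fin n × Bool => ∀ r, y (C r).1 ≠ (C r).2) =
      univ.map ⟨fun v : Fin k → Fin n => fun r => (v r, !y (v r)), fun v w h => by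
        funext r
        simpa using congrArg (fun C : Fin k → Fin n × Bool => (C r).1) h⟩ := by
    ext C
    simp only [mem_filter, mem_univ, true_and, mem_map, Function.Embedding.coeFn_mk]
    constructor
    · intro h
      refine ⟨fun r => (C r).1, funext fun r => Prod.ext rfl ?_⟩
      dsimp only
      have hr := h r
      revert hr
      cases y (C r).1 <;> cases (C r).2 <;> decide
    · rintro ⟨v, rfl⟩ r
      dsimp only
      cases y (v r) <;> decide
  rw [key, card_map, card_univ, Fintype.card_fun, Fintype.card_fin, Fintype.card_fin]

/-- Hence, as a real number, the clauses NOT falsified by `y` number `(1 - 2^{-k}) · (2n)^k`. -/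
theorem ind_card_notFalsified (y : Fin n → Bool) :
    ((univ.filter fun C : Fin k → Fin n × Bool => ¬∀ r, y (C r).1 ≠ (C r).2).card : ℝ) =
      (1 - (1 / 2 : ℝ) ^ k) * Fintype.card (Fin k → Fin n × Bool) := by
  have h := Finset.card_filter_add_card_filter_not (s := (univ : Finset (Fin k → Fin n × Bool)))
    (fun C : Fin k → Fin n × Bool => ∀ r, y (C r).1 ≠ (C r).2)
  rw [ind_card_falsified, card_univ] at h
  have hcard : Fintype.card (Fin k → Fin n × Bool) = (n * 2) ^ k := by
    rw [Fintype.card_fun, Fintype.card_prod, Fintype.card_fin, Fintype.card_fin, Fintype.card_bool]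
  rw [hcard] at h ⊢
  have h' : ((univ.filter fun C : Fin k → Fin n × Bool => ¬∀ r, y (C r).1 ≠ (C r).2).card : ℝ) =
      ((n : ℝ) * 2) ^ k - (n : ℝ) ^ k := by
    have := congrArg (Nat.cast : ℕ → ℝ) h
    push_cast at this
    linarith
  have hpow : (1 / 2 : ℝ) ^ k * ((n : ℝ) * 2) ^ k = (n : ℝ) ^ k := by
    rw [← mul_pow]
    congr 1
    ring
  rw [h']
  push_cast
  linear_combination hpow

/-- The instances whose clauses outside `S` are not falsified by `y` form a product set of
cardinality `(1 - 2^{-k})^{m - #S} · #Inst`. -/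
theorem ind_card_goodOutside (y : Fin n → Bool) (S : Finset (Fin m)) :
    ((Fintype.piFinset fun i : Fin m => if i ∈ S then (univ : Finset (Fin k → Fin n × Bool))
        else univ.filter fun C : Fin k → Fin n × Bool => ¬∀ r, y (C r).1 ≠ (C r).2).card : ℝ) =
      (1 - (1 / 2 : ℝ) ^ k) ^ (m - S.card) * Fintype.card (Inst m k n) := by
  have hS : (univ.filter fun i : Fin m => i ∈ S) = S := by ext i; simp
  have hSc : (univ.filter fun i : Fin m => ¬i ∈ S) = Sᶜ := by ext i; simp
  rw [Fintype.card_piFinset, prod_congr rfl fun i _ => apply_ite Finset.card (i ∈ S) _ _, prod_ite,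
    prod_const, prod_const, hS, hSc, Finset.card_compl, Fintype.card_fin]
  push_cast
  rw [card_univ, ind_card_notFalsified y]
  have hInst : (Fintype.card (Inst m k n) : ℝ) = (Fintype.card (Fin k → Fin n × Bool) : ℝ) ^ m := by
    rw [Fintype.card_fun, Fintype.card_fin]
    push_cast
    rfl
  have hSm : S.card ≤ m := by simpa using S.card_le_univ
  rw [hInst, mul_pow]
  set N : ℝ := (Fintype.card (Fin k → Fin n × Bool) : ℝ)
  calc N ^ S.card * ((1 - (1 / 2 : ℝ) ^ k) ^ (m - S.card) * N ^ (m - S.card))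
      = (1 - (1 / 2 : ℝ) ^ k) ^ (m - S.card) * N ^ (S.card + (m - S.card)) := by rw [pow_add]; ring
    _ = (1 - (1 / 2 : ℝ) ^ k) ^ (m - S.card) * N ^ m := by rw [Nat.add_sub_cancel' hSm]

/-- **Single-instance validity count.** For a fixed assignment `y`, the instances with at most `J`
clauses violated by `y` number at most `Σ_{j ≤ J} C(m,j) · (1 - 2^{-k})^{m-J} · #Inst`: the set of
violated clause indices has some size `j ≤ J`, and outside it every clause avoids the `n^k`
falsified ones. -/
theorem ind_card_violCount_le (y : Fin n → Bool) (J : ℕ) :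
    ((univ.filter fun Φ : Inst m k n => violCount y Φ ≤ J).card : ℝ) ≤
      (∑ j ∈ range (J + 1), (m.choose j : ℝ)) * (1 - (1 / 2 : ℝ) ^ k) ^ (m - J) *
        Fintype.card (Inst m k n) := by
  obtain ⟨G, hG⟩ : ∃ G : Finset (Fin m) → Finset (Inst m k n), ∀ S, G S =
      Fintype.piFinset fun i : Fin m => if i ∈ S then (univ : Finset (Fin k → Fin n × Bool))
        else univ.filter fun C : Fin k → Fin n × Bool => ¬∀ r, y (C r).1 ≠ (C r).2 :=
    ⟨_, fun _ => rfl⟩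
  have hq0 : 0 ≤ 1 - (1 / 2 : ℝ) ^ k := sub_nonneg.2 (pow_le_one₀ (by norm_num) (by norm_num))
  have hq1 : 1 - (1 / 2 : ℝ) ^ k ≤ 1 := sub_le_self _ (by positivity)
  -- the cover by product sets, indexed by the set of violated clauses
  have hsub : (univ.filter fun Φ : Inst m k n => violCount y Φ ≤ J) ⊆
      (range (J + 1)).biUnion fun j => (powersetCard j univ).biUnion G := by
    intro Φ hΦ
    simp only [mem_filter, mem_univ, true_and] at hΦ
    simp only [mem_biUnion, mem_range, mem_powersetCard]
    refine ⟨violCount y Φ, Nat.lt_succ_of_le hΦ,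
      univ.filter fun i : Fin m => ∀ r, y (Φ i r).1 ≠ (Φ i r).2, ⟨subset_univ _, rfl⟩, ?_⟩
    rw [hG, Fintype.mem_piFinset]
    intro i
    split_ifs with hi
    · exact mem_univ _
    · simp only [mem_filter, mem_univ, true_and] at hi ⊢
      exact hi
  have hGcard : ∀ j ∈ range (J + 1), ∀ S ∈ powersetCard j (univ : Finset (Fin m)),
      ((G S).card : ℝ) ≤ (1 - (1 / 2 : ℝ) ^ k) ^ (m - J) * Fintype.card (Inst m k n) := by
    intro j hj S hS
    rw [mem_powersetCard] at hS
    rw [hG, ind_card_goodOutside]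
    refine mul_le_mul_of_nonneg_right (pow_le_pow_of_le_one hq0 hq1 ?_) (Nat.cast_nonneg _)
    have := mem_range.1 hj
    omega
  calc ((univ.filter fun Φ : Inst m k n => violCount y Φ ≤ J).card : ℝ)
      ≤ ∑ j ∈ range (J + 1), ∑ S ∈ powersetCard j (univ : Finset (Fin m)), ((G S).card : ℝ) := by
        exact_mod_cast (card_le_card hsub).trans
          (card_biUnion_le.trans (sum_le_sum fun j _ => card_biUnion_le))
    _ ≤ ∑ j ∈ range (J + 1), ∑ S ∈ powersetCard j (univ : Finset (Fin m)),
          (1 - (1 / 2 : ℝ) ^ k) ^ (m - J) * Fintype.card (Inst m k n) :=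
        sum_le_sum fun j hj => sum_le_sum fun S hS => hGcard j hj S hS
    _ = (∑ j ∈ range (J + 1), (m.choose j : ℝ)) * (1 - (1 / 2 : ℝ) ^ k) ^ (m - J) *
          Fintype.card (Inst m k n) := by
        rw [sum_mul, sum_mul]
        refine sum_congr rfl fun j _ => ?_
        rw [sum_const, card_powersetCard, card_univ, Fintype.card_fin, nsmul_eq_mul]
        ring

end IndCount

/-! ## Stub F, part 2: the coordinates read by an instance of the path -/

section IndCoords

open Finset

variable {k m n : ℕ}

/-- Every time `t ≤ k·(m k)` is a splice point `(r, q)` with `r < k` and `q ≤ m k`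
(for `k ≥ 1`, `m k ≥ 1`; the endpoint is `(k - 1, m k)`). -/
theorem ind_exists_splicePt (hk : 1 ≤ k) (hW : 1 ≤ m * k) {t : ℕ} (ht : t ≤ k * (m * k)) :
    ∃ r : Fin k, ∃ q : ℕ, q ≤ m * k ∧ t = (r : ℕ) * (m * k) + q := by
  rcases lt_or_eq_of_le ht with hlt | rfl
  · exact ⟨⟨t / (m * k), Nat.div_lt_of_lt_mul (Nat.lt_of_lt_of_eq hlt (Nat.mul_comm k (m * k)))⟩,
      t % (m * k), (Nat.mod_lt _ hW).le, (Nat.div_add_mod' t (m * k)).symm⟩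
  · obtain ⟨k', rfl⟩ : ∃ k', k = k' + 1 := ⟨k - 1, by omega⟩
    exact ⟨Fin.last k', m * (k' + 1), le_rfl, by rw [Fin.val_last]; ring⟩

/-- **Source disjointness** (the heart of BH Prop. 4.7 (ii)): at splice points `(r', q')` and
`(r₀, q₀)`, `q₀ ≤ W`, at least one full sweep `W` apart (`r' W + q' + W ≤ r₀ W + q₀`), every
literal position `p < W` is read from different arrays. -/
theorem ind_src_ne {W r' q' r₀ q₀ p : ℕ} (hp : p < W) (hq₀ : q₀ ≤ W)
    (h : r' * W + q' + W ≤ r₀ * W + q₀) :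
    (if p < q' then r' + 1 else r') ≠ (if p < q₀ then r₀ + 1 else r₀) := by
  have e1 : (r₀ + 1) * W = r₀ * W + W := by ring
  have e2 : (r' + 1) * W = r' * W + W := by ring
  rcases Nat.lt_or_ge r₀ r' with hlt | h1
  · -- `r₀ < r'` contradicts `h`
    have hmul : (r₀ + 1) * W ≤ r' * W := Nat.mul_le_mul_right W hlt
    exfalso
    omega
  · rcases Nat.lt_or_ge (r' + 1) r₀ with h2 | h2
    · -- two sweeps apart
      split_ifs <;> omega
    · rcases Nat.eq_or_lt_of_le h2 with h3 | h3
      · -- consecutive sweeps: `q' ≤ q₀`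
        subst h3
        split_ifs <;> omega
      · -- same sweep: `q' = 0`, `q₀ = W`
        obtain rfl : r₀ = r' := by omega
        split_ifs <;> omega

/-- **Coordinates.** The instance at a time `t₀ ≤ k·(m k)` reads literal position `(a, b)` from
the array `c a b`, and an instance at least one full sweep earlier never reads array `c a b` at
position `(a, b)`: it is determined by the coordinates of `Ψ` off the graph of `c`. -/
theorem ind_coords {t₀ : ℕ} (ht₀ : t₀ ≤ k * (m * k)) :
    ∃ c : Fin m → Fin k → Fin (k + 1),
      (∀ (Ψ : PathSp k m n) (a : Fin m) (b : Fin k), instAt Ψ t₀ a b = Ψ (c a b) a b) ∧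
      ∀ t', t' + m * k ≤ t₀ → ∀ Ψ Ψ' : PathSp k m n,
        (∀ s a b, s ≠ c a b → Ψ s a b = Ψ' s a b) → instAt Ψ t' = instAt Ψ' t' := by
  rcases Nat.eq_zero_or_pos k with rfl | hk
  · -- `k = 0`: no literal positions
    exact ⟨fun _ b => b.elim0, fun Ψ a b => b.elim0,
      fun t' _ Ψ Ψ' _ => funext fun a => funext fun b => b.elim0⟩
  rcases Nat.eq_zero_or_pos m with rfl | hm
  · -- `m = 0`: no clauses
    exact ⟨fun a _ => a.elim0, fun Ψ a => a.elim0, fun t' _ Ψ Ψ' _ => funext fun a => a.elim0⟩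
  have hW : 1 ≤ m * k := Nat.mul_pos hm hk
  obtain ⟨r₀, q₀, hq₀, rfl⟩ := ind_exists_splicePt hk hW ht₀
  refine ⟨fun a b => if (a : ℕ) * k + b < q₀ then r₀.succ else r₀.castSucc, fun Ψ a b => ?_,
    fun t' ht' Ψ Ψ' hΨ => ?_⟩
  · rw [instAt_eq_splice Ψ r₀ hq₀]
    simp only [splice]
    split_ifs <;> rfl
  · obtain ⟨r', q', hq', rfl⟩ := ind_exists_splicePt hk hW (show t' ≤ k * (m * k) by omega)
    rw [instAt_eq_splice Ψ r' hq', instAt_eq_splice Ψ' r' hq']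
    funext a b
    have hp : (a : ℕ) * k + b < m * k := by
      have hb := b.isLt
      calc (a : ℕ) * k + b < (a : ℕ) * k + k := by omega
        _ = ((a : ℕ) + 1) * k := by ring
        _ ≤ m * k := Nat.mul_le_mul_right k a.isLt
    have hne := ind_src_ne hp hq₀ ht'
    -- the value of `c a b`
    have hcv : ∀ s : Fin (k + 1), s = (if (a : ℕ) * k + b < q₀ then r₀.succ else r₀.castSucc) →
        (s : ℕ) = if (a : ℕ) * k + b < q₀ then (r₀ : ℕ) + 1 else r₀ := by
      rintro s rfl
      split_ifs <;> simp
    simp only [splice]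
    split_ifs with h'
    · refine hΨ _ a b fun heq => hne ?_
      rw [if_pos h', ← hcv _ heq, Fin.val_succ]
    · refine hΨ _ a b fun heq => hne ?_
      rw [if_neg h', ← hcv _ heq, Fin.val_castSucc]

end IndCoords

/-! ## Stub F, part 3: the Fubini split -/

section IndFubini

open Finset

variable {k m n : ℕ}

/-- **The Fubini split, abstract form.** Let `c` assign an array to every literal position, let
`proj Ψ` read `Ψ` along the graph of `c`, and let the event `B Ψ y` depend only on the coordinates
of `Ψ` off the graph of `c`. If for every `y` at most `V · #Inst` instances satisfy `A · y`, and for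
every path at most `Bc` assignments `y` satisfy `B Ψ ·`, then the paths carrying some `y` with
`A (proj Ψ) y ∧ B Ψ y` number at most `Bc · V · #PathSp`: mask the graph coordinates, union-bound
over the admissible `y` of the masked path, and count the free instance along the graph. -/
theorem ind_fubini (hn : 1 ≤ n) (c : Fin m → Fin k → Fin (k + 1))
    (proj : PathSp k m n → Inst m k n) (hproj : ∀ Ψ a b, proj Ψ a b = Ψ (c a b) a b)
    (A : Inst m k n → (Fin n → Bool) → Prop) (B : PathSp k m n → (Fin n → Bool) → Prop)
    [∀ Φ y, Decidable (A Φ y)] [∀ Ψ y, Decidable (B Ψ y)]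
    (hB : ∀ Ψ Ψ' : PathSp k m n, (∀ s a b, s ≠ c a b → Ψ s a b = Ψ' s a b) →
      ∀ y, B Ψ y → B Ψ' y)
    {V Bc : ℝ} (hV0 : 0 ≤ V)
    (hV : ∀ y, ((univ.filter fun Φ => A Φ y).card : ℝ) ≤ V * Fintype.card (Inst m k n))
    (hBc : ∀ Ψ, ((univ.filter fun y => B Ψ y).card : ℝ) ≤ Bc) :
    ((univ.filter fun Ψ => ∃ y, A (proj Ψ) y ∧ B Ψ y).card : ℝ) ≤
      Bc * V * Fintype.card (PathSp k m n) := by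
  -- masking the graph coordinates (by a default literal) and merging an instance back in
  obtain ⟨mask, hmask⟩ : ∃ mask : PathSp k m n → PathSp k m n,
      ∀ Ψ s a b, mask Ψ s a b = if s = c a b then (⟨0, hn⟩, false) else Ψ s a b :=
    ⟨fun Ψ s a b => if s = c a b then (⟨0, hn⟩, false) else Ψ s a b, fun _ _ _ _ => rfl⟩
  obtain ⟨merge, hmerge⟩ : ∃ merge : PathSp k m n → Inst m k n → PathSp k m n,
      ∀ Θ Φ s a b, merge Θ Φ s a b = if s = c a b then Φ a b else Θ s a b :=
    ⟨fun Θ Φ s a b => if s = c a b then Φ a b else Θ s a b, fun _ _ _ _ _ => rfl⟩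
  have hBc0 : 0 ≤ Bc := le_trans (Nat.cast_nonneg _) (hBc fun _ _ _ => (⟨0, hn⟩, false))
  -- merging the projection into the masked path restores the path
  have h1 : ∀ Ψ, merge (mask Ψ) (proj Ψ) = Ψ := fun Ψ => by
    funext s a b
    rw [hmerge, hmask]
    split_ifs with hs
    · rw [hproj, hs]
    · rfl
  -- `B` only reads the coordinates kept by the mask
  have h2 : ∀ Ψ y, B Ψ y → B (mask Ψ) y := fun Ψ y =>
    hB Ψ (mask Ψ) (fun s a b hs => by rw [hmask, if_neg hs]) y
  -- the cover
  have hsub : (univ.filter fun Ψ => ∃ y, A (proj Ψ) y ∧ B Ψ y) ⊆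
      (univ.image mask).biUnion fun Θ => (univ.filter fun y => B Θ y).biUnion fun y =>
        (univ.filter fun Φ => A Φ y).image (merge Θ) := by
    intro Ψ hΨ
    simp only [mem_filter, mem_univ, true_and] at hΨ
    obtain ⟨y, hA, hBy⟩ := hΨ
    simp only [mem_biUnion, mem_filter, mem_univ, true_and, mem_image]
    exact ⟨mask Ψ, ⟨Ψ, rfl⟩, y, h2 Ψ y hBy, proj Ψ, hA, h1 Ψ⟩
  -- merging is injective on (masked paths) × (instances)
  have hinj : Set.InjOn (fun x : PathSp k m n × Inst m k n => merge x.1 x.2)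
      ↑(univ.image mask ×ˢ (univ : Finset (Inst m k n))) := by
    rintro ⟨Θ₁, Φ₁⟩ hx₁ ⟨Θ₂, Φ₂⟩ hx₂ heq
    rw [mem_coe, mem_product] at hx₁ hx₂
    obtain ⟨Ψ₁, -, rfl⟩ := mem_image.1 hx₁.1
    obtain ⟨Ψ₂, -, rfl⟩ := mem_image.1 hx₂.1
    dsimp only at heq
    have hΦ : Φ₁ = Φ₂ := by
      funext a b
      have := congrFun (congrFun (congrFun heq (c a b)) a) b
      rwa [hmerge, hmerge, if_pos rfl, if_pos rfl] at this
    simp only [Prod.mk.injEq]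
    refine ⟨?_, hΦ⟩
    funext s a b
    by_cases hs : s = c a b
    · rw [hmask, hmask, if_pos hs, if_pos hs]
    · have := congrFun (congrFun (congrFun heq s) a) b
      rwa [hmerge, hmerge, if_neg hs, if_neg hs] at this
  have hMcard : (((univ.image mask).card : ℕ) : ℝ) * Fintype.card (Inst m k n) ≤
      Fintype.card (PathSp k m n) := by
    have := card_le_card_of_injOn (t := univ)
      (fun x : PathSp k m n × Inst m k n => merge x.1 x.2) (fun x _ => by simp) hinj
    rw [card_product, card_univ, card_univ] at this
    exact_mod_cast this
  -- the count
  have hnat : (univ.filter fun Ψ => ∃ y, A (proj Ψ) y ∧ B Ψ y).card ≤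
      ∑ Θ ∈ univ.image mask, ∑ y ∈ univ.filter (fun y => B Θ y),
        ((univ.filter fun Φ => A Φ y).image (merge Θ)).card :=
    (card_le_card hsub).trans (card_biUnion_le.trans (sum_le_sum fun Θ _ => card_biUnion_le))
  calc ((univ.filter fun Ψ => ∃ y, A (proj Ψ) y ∧ B Ψ y).card : ℝ)
      ≤ ∑ Θ ∈ univ.image mask, ∑ y ∈ univ.filter (fun y => B Θ y),
          (((univ.filter fun Φ => A Φ y).image (merge Θ)).card : ℝ) := by exact_mod_cast hnat
    _ ≤ ∑ Θ ∈ univ.image mask, ∑ y ∈ univ.filter (fun y => B Θ y),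
          V * Fintype.card (Inst m k n) :=
        sum_le_sum fun Θ _ => sum_le_sum fun y _ =>
          le_trans (by exact_mod_cast card_image_le) (hV y)
    _ = ∑ Θ ∈ univ.image mask,
          ((univ.filter fun y => B Θ y).card : ℝ) * (V * Fintype.card (Inst m k n)) := by
        refine sum_congr rfl fun Θ _ => ?_
        rw [sum_const, nsmul_eq_mul]
    _ ≤ ∑ Θ ∈ univ.image mask, Bc * (V * Fintype.card (Inst m k n)) :=
        sum_le_sum fun Θ _ => mul_le_mul_of_nonneg_right (hBc Θ)
          (mul_nonneg hV0 (Nat.cast_nonneg _))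
    _ = Bc * V * (((univ.image mask).card : ℕ) * Fintype.card (Inst m k n)) := by
        rw [sum_const, nsmul_eq_mul]
        ring
    _ ≤ Bc * V * Fintype.card (PathSp k m n) :=
        mul_le_mul_of_nonneg_left hMcard (mul_nonneg hBc0 hV0)

end IndFubini

/-! ## Stub F: the statement `IndepCount` -/

section IndMain

open Finset

/-- **Stub F — the one Fubini split** (BH Prop. 4.7 (ii)): for a fixed section `g`, a time
`t₀ ≤ k·(m k)` and earlier times `ts j ≤ t₀ - m k`, the paths carrying a `J`-valid `y` for the
instance at time `t₀` of conditional entropy `≤ b` relative to the earlier outputs `g (instAt Ψ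
(ts j))` are a fraction at most `Bc · Σ_{j ≤ J} C(m,j) · (1 - 2^{-k})^{m-J}` of all paths, where
`Bc` bounds the number of admissible candidates for EVERY prefix. Proof: the instance at time `t₀`
reads coordinates of `Ψ` disjoint from those read at the times `ts j` (`ind_coords`), so the count
splits (`ind_fubini`) into the candidate bound times the single-instance validity count
(`ind_card_violCount_le`). -/
theorem stub_indepCount :
  ∀ (k m n : ℕ) (g : Inst m k n → Fin n → Bool) (ℓ t₀ : ℕ) (ts : Fin ℓ → ℕ) (J : ℕ) (b Bc : ℝ),
    1 ≤ n → t₀ ≤ k * (m * k) → (∀ j, ts j + m * k ≤ t₀) →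
    (∀ R : ℕ → Fin n → Bool,
      ((Finset.univ.filter fun y : Fin n → Bool => condEnt (withRung R ℓ y) ℓ ≤ b).card : ℝ) ≤
        Bc) →
    ((Finset.univ.filter fun Ψ : PathSp k m n => ∃ y : Fin n → Bool,
        violCount y (instAt Ψ t₀) ≤ J ∧
        condEnt (withRung (seqOf fun j : Fin ℓ => g (instAt Ψ (ts j))) ℓ y) ℓ ≤ b).card : ℝ) ≤
      Bc * (∑ j ∈ Finset.range (J + 1), (m.choose j : ℝ)) * (1 - (1 / 2 : ℝ) ^ k) ^ (m - J) *
        Fintype.card (PathSp k m n) := by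
  intro k m n g ℓ t₀ ts J b Bc hn ht₀ hts hBc
  obtain ⟨c, hc, hc'⟩ := ind_coords (n := n) ht₀
  have hV0 : 0 ≤ (∑ j ∈ Finset.range (J + 1), (m.choose j : ℝ)) * (1 - (1 / 2 : ℝ) ^ k) ^ (m - J) :=
    mul_nonneg (sum_nonneg fun _ _ => Nat.cast_nonneg _)
      (pow_nonneg (sub_nonneg.2 (pow_le_one₀ (by norm_num) (by norm_num))) _)
  have key := ind_fubini hn c (fun Ψ => instAt Ψ t₀) hc (fun Φ y => violCount y Φ ≤ J)
    (fun Ψ y => condEnt (withRung (seqOf fun j : Fin ℓ => g (instAt Ψ (ts j))) ℓ y) ℓ ≤ b)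
    (fun Ψ Ψ' hΨ y hy => by
      have hfun : (seqOf fun j : Fin ℓ => g (instAt Ψ' (ts j))) =
          seqOf fun j : Fin ℓ => g (instAt Ψ (ts j)) := by
        congr 1
        funext j
        rw [hc' (ts j) (hts j) Ψ Ψ' hΨ]
      simp only [hfun]
      exact hy)
    hV0 (fun y => ind_card_violCount_le y J) (fun Ψ => hBc _)
  simpa only [mul_assoc] using key

end IndMain

end Summit.PneNP.PneNP.Cruxes.NoStableSection.DartGame
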